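import Summits.QuantumFields.QCD.Theorems.QuarksAsStableActionStableActionBridgeDefs
import Literature.MathematicalPhysics.QuantumFieldTheory.QCDSiteReflectionPositivityProofs
import Literature.MathematicalPhysics.QuantumFieldTheory.QCDTimeReflectionProofs
import Literature.MathematicalPhysics.QuantumLattice.GrassmannIntegralPartial
import HarnessLib

noncomputable section

open scoped SchwartzMap BigOperators ComplexConjugate
open MeasureTheory Filter Topology
open Literature.MathematicalPhysics.QuantumFieldTheory Literature.MathematicalPhysics.QuantumLattice
open Literature.MathematicalPhysics.QuantumLattice.GrassmannAlgebra
open Literature.MathematicalPhysics.AQFT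
open Literature.Probability.LatticeModels (box Site)

namespace Summit.QuantumFields.QCD.Cruxes.StableActionBridge.Sketch

local notation "E4" => EuclideanSpace ℝ (Fin 4)
local notation "𝔾" => Matrix.specialUnitaryGroup (Fin 3) ℂ

/-- W2b: abstract site-reflection positivity of the thermal functional. -/
theorem stub_abstractThermalRP : ∀ {Nf : ℕ} (S : ℕ), 1 ≤ S → ∀ (β : ℝ), 0 ≤ β →
    ∀ (mq : Fin Nf → ℝ), (∀ f, -1 < mq f) →
    ∀ (X : GaugeConfig 4 (2 * S + 1) 𝔾 → FermiAlg Nf (2 * S + 1)),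
      (∀ U U' : GaugeConfig 4 (2 * S + 1) 𝔾, (∀ e ∈ posLinks S, U e = U' e) → X U = X U') →
      (∀ U : GaugeConfig 4 (2 * S + 1) 𝔾,
        X U ∈ spectatorSubalgebra ℂ (negGens Nf (2 * S + 1) ∪ zeroGens Nf (2 * S + 1))) →
      CoeffRegular X →
      0 ≤ (qcdTorusExpectAP β (2 * S + 1) mq (fun U => X U * torusTheta (X U.negReflect))).re ∧
        (qcdTorusExpectAP β (2 * S + 1) mq (fun U => X U * torusTheta (X U.negReflect))).im = 0 := by
  sorry

/-- W2a-loc: locality and Grassmann support of the insertions (forward and reflected-backward). -/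
theorem stub_insertion_local : ∀ {Nf : ℕ} (S : ℕ), 1 ≤ S → ∀ (s : QCDField Nf) (y : Site 4),
    (1 ≤ y 0 → y 0 + 1 ≤ S → ∀ U U' : GaugeConfig 4 (2 * S + 1) 𝔾, (∀ e ∈ posLinks S, U e = U' e) →
      insertion U s y = insertion U' s y) ∧
    (2 ≤ y 0 → y 0 ≤ S → ∀ U U' : GaugeConfig 4 (2 * S + 1) 𝔾, (∀ e ∈ posLinks S, U e = U' e) →
      insertion U.negReflect s (siteReflect y) = insertion U'.negReflect s (siteReflect y)) ∧
    (1 ≤ y 0 → y 0 ≤ S → ∀ U : GaugeConfig 4 (2 * S + 1) 𝔾,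
      insertion U s y ∈ spectatorSubalgebra ℂ (negGens Nf (2 * S + 1) ∪ zeroGens Nf (2 * S + 1)) ∧
      torusTheta (insertion U.negReflect s (siteReflect y)) ∈
        spectatorSubalgebra ℂ (negGens Nf (2 * S + 1) ∪ zeroGens Nf (2 * S + 1))) := by
  sorry

/-- W2a-refl (mesons): the reflection law of the pseudoscalar insertions. -/
theorem stub_meson_reflect : ∀ {Nf : ℕ} (L : ℕ) [NeZero L] (f g : Fin Nf) (y : Site 4) (U : GaugeConfig 4 L 𝔾),
    torusTheta (insertion U.negReflect (QCDField.pseudoRe f g) (siteReflect y)) = insertion U (QCDField.pseudoRe f g) y ∧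
    torusTheta (insertion U.negReflect (QCDField.pseudoIm f g) (siteReflect y)) = insertion U (QCDField.pseudoIm f g) y := by
  sorry

end Summit.QuantumFields.QCD.Cruxes.StableActionBridge.Sketch

end
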